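import Summits.KontsevichZagierPeriods.KontsevichZagierPeriods.Theorems.SoloInformedSectorPiece
import Summits.KontsevichZagierPeriods.KontsevichZagierPeriods.Theorems.SoloInformedCornerCover
import Summits.KontsevichZagierPeriods.KontsevichZagierPeriods.Theorems.SoloInformedSmoothUnit
import HarnessLib

/-!
# The corner step of the vertex recursion: the corner cell from the children

Solo programme `solo-KontsevichZagierPeriods-informed`, session s111, step (γ-10) of the kernel
project PRES-RAT(2).

Let `(F, D, Ω)` be a corner configuration with tangent-cone polynomial `cone_F ≠ 0` of order `m`
and integrand `P/D`.  Assume that every *child pair* is corner-presentable: the `F`-children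
`(child_F(t, κ, λ), D')` for all admissible apices `t ≥ 0` (sector slopes in `[0, ∞)`, no tangent
direction in `t + λ (0, 1]`), and the swapped children `(child_{swap F}(0, κ, λ), swap D')`
(no tangent direction of `swap F` in `(0, λ]`).  Then `P/D` is presentable on the corner cell
`Ω ∩ [0, 1/N]²` for every `N ≥ 1`.

Proof: choose an integer `M` exceeding every non-negative real root of `cone_F` and the
reciprocal of every positive real root of `cone_{swap F}`; cover the corner cell
(file `SoloInformedCornerCover`) by the fan `x₁ < M x₀, x₀ < 1/(NM)` (cut along the slope set
`H = R ∪ ½(R + R)`, `R = {0, M} ∪ roots⁺`, into sectors with a root-free half-open slope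
interval — consecutive elements of `H` are never both in `R` — each presentable by the sector
piece lemma, file `SoloInformedSectorPiece`), the swapped fan `x₀ < x₁ / M, x₁ < 1/N` (one swapped
sector with apex slope `0`), and the `NM`-grid cells off the corner (leaves, by the punctured
smoothness invariant).

References: Kontsevich–Zagier, *Periods* (2001), §1.2; Bierstone–Milman, *Semianalytic and
subanalytic sets*, Publ. IHES 67 (1988), §4 (local blowing up).
-/

noncomputable section

open scoped BigOperators
open MeasureTheory Set
open Literature.NumberTheory.Transcendental Literature.NumberTheory.Transcendental.KZ
open Literature.ModelTheory.ExponentialFields (IsSemialgebraic)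

namespace Summit.KontsevichZagierPeriods.KontsevichZagierPeriods.Theorems

variable {K : Type*} [Field K] [Algebra K ℝ]

/-- A sector does not depend on which end of its slope interval is the apex. [this work] -/
theorem soloInformed_sector_symm (κ a b : ℝ) :
    soloInformedSector κ b (a - b) = soloInformedSector κ a (b - a) := by
  ext z
  simp only [soloInformedSector, mem_setOf_eq]
  by_cases hD : (b - a) * z 0 = 0
  · have hD' : (a - b) * z 0 = 0 := by linarith
    rw [hD, hD', div_zero, div_zero]
  · have key : (z 1 - b * z 0) / ((a - b) * z 0) = 1 - (z 1 - a * z 0) / ((b - a) * z 0) := by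
      have hba : (a - b) * z 0 = -((b - a) * z 0) := by ring
      rw [hba, div_neg, eq_sub_iff_add_eq, neg_add_eq_sub, ← sub_div,
        show z 1 - a * z 0 - (z 1 - b * z 0) = (b - a) * z 0 by ring, div_self hD]
    rw [key]
    constructor
    · rintro ⟨h0, hκ, h1, h2⟩; exact ⟨h0, hκ, by linarith, by linarith⟩
    · rintro ⟨h0, hκ, h1, h2⟩; exact ⟨h0, hκ, by linarith, by linarith⟩

/-- A real bound: a natural number exceeding every element of a finite set of reals.
[routine] -/
theorem soloInformed_exists_nat_gt_finset (S : Finset ℝ) : ∃ M : ℕ, 0 < M ∧ ∀ x ∈ S, x < M := by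
  refine ⟨⌈∑ x ∈ S, |x|⌉₊ + 1, Nat.succ_pos _, fun x hx => ?_⟩
  have h1 : x ≤ ∑ y ∈ S, |y| :=
    (le_abs_self x).trans (Finset.single_le_sum (fun y _ => abs_nonneg y) hx)
  have h2 : (∑ y ∈ S, |y|) ≤ (⌈∑ y ∈ S, |y|⌉₊ : ℝ) := Nat.le_ceil _
  push_cast
  linarith

/-- **The corner step.**  For a corner configuration `(F, D, Ω)` with `cone_F ≠ 0` of order `m`
and an integrand `P/D` (`ord P ≥ s`, `ord D ≥ c + d₁`, `s + 1 = c + s₁`): if all `F`-children with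
non-negative apex and all swapped children with apex `0` are corner-presentable, then `P/D` is
presentable on every corner cell `Ω ∩ [0, 1/N]²`. [this work] -/
theorem soloInformed_presOn_cornerCell_of_children [CharZero K]
    (hK : ∀ c : K, IsAlgebraic ℚ (algebraMap K ℝ c)) (hKrc : SoloInformedRealRootClosed K)
    {F D : MvPolynomial (Fin 2) K} {Ω : Set (Fin 2 → ℝ)} (h : SoloInformedCornerCfg F D Ω)
    {m : ℕ} (hm : ∀ a ∈ F.support, m ≤ a 0 + a 1) (hcone : soloInformedConePolyK F m ≠ 0)
    {s c s₁ d₁ : ℕ} (hd : ∀ a ∈ D.support, c + d₁ ≤ a 0 + a 1) {P : MvPolynomial (Fin 2) K}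
    (hsP : ∀ a ∈ P.support, s ≤ a 0 + a 1) (hss : s + 1 = c + s₁)
    (hchildF : ∀ t κ lam : K, 0 < algebraMap K ℝ κ → algebraMap K ℝ κ ≤ 1 →
      algebraMap K ℝ lam ≠ 0 → 0 ≤ algebraMap K ℝ t → 0 ≤ algebraMap K ℝ t + algebraMap K ℝ lam →
      algebraMap K ℝ κ * algebraMap K ℝ t ≤ 1 →
      algebraMap K ℝ κ * (algebraMap K ℝ t + algebraMap K ℝ lam) ≤ 1 →
      (∀ y : ℝ, 0 < y → y ≤ 1 → Polynomial.aeval (algebraMap K ℝ t + algebraMap K ℝ lam * y)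
        (soloInformedConePolyK F m) ≠ 0) →
      SoloInformedCornerOK (soloInformedChildK F m t κ lam) (soloInformedChildDenK D c d₁ t κ lam))
    (hchildS : ∀ κ lam : K, 0 < algebraMap K ℝ κ → algebraMap K ℝ κ ≤ 1 →
      0 < algebraMap K ℝ lam → algebraMap K ℝ lam ≤ 1 →
      (∀ y : ℝ, 0 < y → y ≤ 1 → Polynomial.aeval (algebraMap K ℝ lam * y)
        (soloInformedConePolyK (soloInformedSwapK F) m) ≠ 0) →
      SoloInformedCornerOK (soloInformedChildK (soloInformedSwapK F) m 0 κ lam)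
        (soloInformedChildDenK (soloInformedSwapK D) c d₁ 0 κ lam))
    {N : ℕ} (hN : 0 < N) {j : Fin 2 → Fin N} (hj : ∀ i, (j i : ℕ) = 0) :
    SoloInformedPresOn (Ω ∩ soloInformedGridCell N j)
      fun z => (MvPolynomial.aeval z P : ℝ) / MvPolynomial.aeval z D := by
  classical
  set e := algebraMap K ℝ with he_def
  have he : Function.Injective e := (algebraMap K ℝ).injective
  set f : (Fin 2 → ℝ) → ℝ := fun z => (MvPolynomial.aeval z P : ℝ) / MvPolynomial.aeval z D
    with hf_def
  have hconeS : soloInformedConePolyK (soloInformedSwapK F) m ≠ 0 := by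
    rw [soloInformed_conePolyK_swapK F hm, Ne, Polynomial.reflect_eq_zero_iff]; exact hcone
  -- the root finsets and the integer `M`
  set RF : Finset K := (soloInformedConePolyK F m).roots.toFinset.filter (fun r => 0 ≤ e r)
    with hRF_def
  set RS : Finset K :=
    (soloInformedConePolyK (soloInformedSwapK F) m).roots.toFinset.filter (fun r => 0 < e r)
    with hRS_def
  obtain ⟨M, hM, hMgt⟩ :=
    soloInformed_exists_nat_gt_finset (RF.image e ∪ RS.image (fun r => (e r)⁻¹))
  have hMr : (0 : ℝ) < M := by exact_mod_cast hM
  have hRFlt : ∀ r ∈ RF, e r < M := fun r hr =>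
    hMgt _ (Finset.mem_union_left _ (Finset.mem_image_of_mem _ hr))
  have hRSgt : ∀ r ∈ RS, (M : ℝ)⁻¹ < e r := fun r hr =>
    inv_lt_of_inv_lt₀ (Finset.mem_filter.1 hr).2
      (hMgt _ (Finset.mem_union_right _ (Finset.mem_image_of_mem _ hr)))
  have hrootF : ∀ σ : ℝ, 0 ≤ σ → Polynomial.aeval σ (soloInformedConePolyK F m) = 0 →
      ∃ r ∈ RF, e r = σ := fun σ hσ h0 => by
    obtain ⟨r, hr, hrσ⟩ := soloInformed_exists_root_eq hKrc hcone h0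
    exact ⟨r, Finset.mem_filter.2 ⟨Multiset.mem_toFinset.2 hr, by rw [hrσ]; exact hσ⟩, hrσ⟩
  have hrootS : ∀ σ : ℝ, 0 < σ →
      Polynomial.aeval σ (soloInformedConePolyK (soloInformedSwapK F) m) = 0 → (M : ℝ)⁻¹ < σ :=
    fun σ hσ h0 => by
    obtain ⟨r, hr, hrσ⟩ := soloInformed_exists_root_eq hKrc hconeS h0
    rw [← hrσ]
    exact hRSgt r (Finset.mem_filter.2 ⟨Multiset.mem_toFinset.2 hr, by rw [hrσ]; exact hσ⟩)
  -- the slope set `H = R₀ ∪ ½ (R₀ + R₀)`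
  set R₀ : Finset K := insert 0 (insert (M : K) RF) with hR₀_def
  set H : Finset K := R₀ ∪ (R₀ ×ˢ R₀).image (fun p => (p.1 + p.2) / 2) with hH_def
  have hR₀H : ∀ a ∈ R₀, a ∈ H := fun a ha => Finset.mem_union_left _ ha
  have hmidH : ∀ a ∈ R₀, ∀ b ∈ R₀, (a + b) / 2 ∈ H := fun a ha b hb =>
    Finset.mem_union_right _ (Finset.mem_image.2 ⟨(a, b), Finset.mem_product.2 ⟨ha, hb⟩, rfl⟩)
  have heM : e (M : K) = M := map_natCast e M
  have hR₀le : ∀ a ∈ R₀, 0 ≤ e a ∧ e a ≤ M := by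
    intro a ha
    rcases Finset.mem_insert.1 ha with rfl | ha
    · rw [map_zero]; exact ⟨le_rfl, hMr.le⟩
    rcases Finset.mem_insert.1 ha with rfl | ha
    · rw [heM]; exact ⟨hMr.le, le_rfl⟩
    · exact ⟨(Finset.mem_filter.1 ha).2, (hRFlt a ha).le⟩
  have emid : ∀ a b : K, e ((a + b) / 2) = (e a + e b) / 2 := fun a b => by
    rw [map_div₀, map_add, map_ofNat]
  have hHle : ∀ a ∈ H, 0 ≤ e a ∧ e a ≤ e (M : K) := by
    intro a ha
    rw [heM]
    rcases Finset.mem_union.1 ha with ha | ha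
    · exact hR₀le a ha
    · obtain ⟨p, hp, rfl⟩ := Finset.mem_image.1 ha
      obtain ⟨h1, h2⟩ := Finset.mem_product.1 hp
      obtain ⟨h1a, h1b⟩ := hR₀le _ h1
      obtain ⟨h2a, h2b⟩ := hR₀le _ h2
      rw [emid]
      constructor <;> linarith
  have h0H : (0 : K) ∈ H := hR₀H 0 (Finset.mem_insert_self _ _)
  have hMH : (M : K) ∈ H := hR₀H _ (Finset.mem_insert_of_mem (Finset.mem_insert_self _ _))
  have hrootR₀ : ∀ x : K, 0 ≤ e x → Polynomial.aeval (e x) (soloInformedConePolyK F m) = 0 →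
      x ∈ R₀ := fun x hx h0 => by
    obtain ⟨r, hr, hrx⟩ := hrootF (e x) hx h0
    rw [← he hrx]
    exact Finset.mem_insert_of_mem (Finset.mem_insert_of_mem hr)
  -- the scale `κ₁ = 1/(N M)`
  have hNM : 0 < N * M := Nat.mul_pos hN hM
  have hNMr : (0 : ℝ) < (N * M : ℕ) := by exact_mod_cast hNM
  set κ₁ : K := ((N * M : ℕ) : K)⁻¹ with hκ₁_def
  have heκ₁ : e κ₁ = ((N * M : ℕ) : ℝ)⁻¹ := by rw [hκ₁_def, map_inv₀, map_natCast]
  have hκ₁0 : 0 < e κ₁ := by rw [heκ₁]; positivity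
  have hκ₁1 : e κ₁ ≤ 1 := by rw [heκ₁]; exact inv_le_one_of_one_le₀ (by exact_mod_cast hNM)
  have hNinv : (N : ℝ)⁻¹ ≤ 1 := inv_le_one_of_one_le₀ (by exact_mod_cast hN)
  have hslope : ∀ a ∈ H, e κ₁ * e a ≤ 1 := by
    intro a ha
    have h1 := (hHle a ha).2
    rw [heM] at h1
    calc e κ₁ * e a ≤ e κ₁ * M := mul_le_mul_of_nonneg_left h1 hκ₁0.le
      _ = (N : ℝ)⁻¹ := by rw [heκ₁]; push_cast; field_simp
      _ ≤ 1 := hNinv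
  -- (A) the fan `x₁ < M x₀`, `x₀ < 1/(N M)`
  have hfan : SoloInformedPresOn (Ω ∩ soloInformedFan (((N * M : ℕ) : ℝ)⁻¹) (e (M : K))) f := by
    rw [← heκ₁]
    refine soloInformed_presOn_inter_fan hK h.isSemialgebraic κ₁ h0H hMH hHle ?_
    intro a ha b hb hab hcons
    have hI : ∀ σ : ℝ, e a < σ → σ < e b →
        Polynomial.aeval σ (soloInformedConePolyK F m) ≠ 0 := by
      intro σ h1 h2 h0
      obtain ⟨r, hr, hrσ⟩ := hrootF σ ((hHle a ha).1.trans h1.le) h0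
      refine hcons r (hR₀H r (Finset.mem_insert_of_mem (Finset.mem_insert_of_mem hr))) ?_
      rw [hrσ]; exact ⟨h1, h2⟩
    have hnb : ¬ (a ∈ R₀ ∧ b ∈ R₀) := by
      rintro ⟨ha0, hb0⟩
      refine hcons _ (hmidH a ha0 b hb0) ?_
      rw [emid]; constructor <;> linarith
    by_cases hb0 : b ∈ R₀
    · -- apex `b`, `λ = a - b < 0`
      have ha0 : a ∉ R₀ := fun ha0 => hnb ⟨ha0, hb0⟩
      have haroot : Polynomial.aeval (e a) (soloInformedConePolyK F m) ≠ 0 := fun h0 =>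
        ha0 (hrootR₀ a (hHle a ha).1 h0)
      have hlam : e (a - b) ≠ 0 := by rw [map_sub]; exact (sub_neg.2 hab).ne
      have hs0 : 0 ≤ e b + e (a - b) := by rw [map_sub]; linarith [(hHle a ha).1]
      have hks : e κ₁ * (e b + e (a - b)) ≤ 1 := by
        rw [map_sub, show e b + (e a - e b) = e a by ring]; exact hslope a ha
      have hroot : ∀ y : ℝ, 0 < y → y ≤ 1 →
          Polynomial.aeval (e b + e (a - b) * y) (soloInformedConePolyK F m) ≠ 0 := by
        intro y hy0 hy1
        rw [map_sub]
        rcases hy1.lt_or_eq with hy1 | rfl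
        · exact hI _ (by nlinarith) (by nlinarith)
        · rw [mul_one, show e b + (e a - e b) = e a by ring]; exact haroot
      have hpiece := soloInformed_presOn_inter_sector_of_child hK h hm hcone hd hsP hss hκ₁0 hκ₁1
        hlam (hHle b hb).1 hs0 (hslope b hb) hks hroot
        (hchildF b κ₁ (a - b) hκ₁0 hκ₁1 hlam (hHle b hb).1 hs0 (hslope b hb) hks hroot)
      rw [map_sub, soloInformed_sector_symm] at hpiece
      rwa [map_sub]
    · -- apex `a`, `λ = b - a > 0`
      have hbroot : Polynomial.aeval (e b) (soloInformedConePolyK F m) ≠ 0 := fun h0 =>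
        hb0 (hrootR₀ b (hHle b hb).1 h0)
      have hlam : e (b - a) ≠ 0 := by rw [map_sub]; exact (sub_pos.2 hab).ne'
      have hs0 : 0 ≤ e a + e (b - a) := by rw [map_sub]; linarith [(hHle b hb).1]
      have hks : e κ₁ * (e a + e (b - a)) ≤ 1 := by
        rw [map_sub, show e a + (e b - e a) = e b by ring]; exact hslope b hb
      have hroot : ∀ y : ℝ, 0 < y → y ≤ 1 →
          Polynomial.aeval (e a + e (b - a) * y) (soloInformedConePolyK F m) ≠ 0 := by
        intro y hy0 hy1
        rw [map_sub]
        rcases hy1.lt_or_eq with hy1 | rfl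
        · exact hI _ (by nlinarith) (by nlinarith)
        · rw [mul_one, show e a + (e b - e a) = e b by ring]; exact hbroot
      exact soloInformed_presOn_inter_sector_of_child hK h hm hcone hd hsP hss hκ₁0 hκ₁1 hlam
        (hHle a ha).1 hs0 (hslope a ha) hks hroot
        (hchildF a κ₁ (b - a) hκ₁0 hκ₁1 hlam (hHle a ha).1 hs0 (hslope a ha) hks hroot)
  -- (B) the swapped fan `x₀ < x₁ / M`, `x₁ < 1/N`: one swapped sector with apex slope `0`
  have hswap : SoloInformedPresOn (Ω ∩ (fun z : Fin 2 → ℝ => (![z 1, z 0] : Fin 2 → ℝ)) ⁻¹'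
      soloInformedFan ((N : ℝ)⁻¹) (e ((M : K)⁻¹))) f := by
    set κ₂ : K := (N : K)⁻¹ with hκ₂_def
    have heκ₂ : e κ₂ = (N : ℝ)⁻¹ := by rw [hκ₂_def, map_inv₀, map_natCast]
    have hκ₂0 : 0 < e κ₂ := by rw [heκ₂]; positivity
    have hκ₂1 : e κ₂ ≤ 1 := heκ₂ ▸ hNinv
    have heMi : e ((M : K)⁻¹) = (M : ℝ)⁻¹ := by rw [map_inv₀, map_natCast]
    have hMi0 : 0 < e ((M : K)⁻¹) := by rw [heMi]; positivity
    have hMi1 : e ((M : K)⁻¹) ≤ 1 := by rw [heMi]; exact inv_le_one_of_one_le₀ (by exact_mod_cast hM)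
    rw [← heκ₂]
    refine soloInformed_presOn_inter_swapFan hK h.isSemialgebraic κ₂ (H := {0, (M : K)⁻¹})
      (by simp) (by simp) ?_ ?_
    · intro a ha
      simp only [Finset.mem_insert, Finset.mem_singleton] at ha
      rcases ha with rfl | rfl
      · rw [map_zero]; exact ⟨le_rfl, hMi0.le⟩
      · exact ⟨hMi0.le, le_rfl⟩
    · intro a ha b hb hab hcons
      simp only [Finset.mem_insert, Finset.mem_singleton] at ha hb
      obtain rfl : a = 0 := by
        rcases ha with rfl | rfl
        · rfl
        rcases hb with rfl | rfl
        · rw [map_zero] at hab; exact absurd hab (not_lt.2 hMi0.le)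
        · exact absurd hab (lt_irrefl _)
      obtain rfl : b = (M : K)⁻¹ := by
        rcases hb with rfl | rfl
        · exact absurd hab (lt_irrefl _)
        · rfl
      have hlam0 : 0 < e ((M : K)⁻¹ - 0) := by rw [sub_zero]; exact hMi0
      have hlam1 : e ((M : K)⁻¹ - 0) ≤ 1 := by rw [sub_zero]; exact hMi1
      have hrootS' : ∀ y : ℝ, 0 < y → y ≤ 1 → Polynomial.aeval (e ((M : K)⁻¹ - 0) * y)
          (soloInformedConePolyK (soloInformedSwapK F) m) ≠ 0 := by
        intro y hy0 hy1 h0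
        have h1 := hrootS _ (mul_pos hlam0 hy0) h0
        rw [sub_zero, heMi] at h1
        have h2 : (M : ℝ)⁻¹ * y ≤ (M : ℝ)⁻¹ := mul_le_of_le_one_right (inv_nonneg.2 hMr.le) hy1
        linarith
      have hks : e κ₂ * (e 0 + e ((M : K)⁻¹ - 0)) ≤ 1 := by
        rw [map_zero, zero_add, sub_zero]
        calc e κ₂ * e ((M : K)⁻¹) ≤ 1 * 1 :=
              mul_le_mul hκ₂1 hMi1 hMi0.le zero_le_one
          _ = 1 := one_mul 1
      have hpiece := soloInformed_presOn_inter_sector_of_child hK (soloInformed_cornerCfg_swap h)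
        (soloInformed_le_deg_swapK hm) hconeS (soloInformed_le_deg_swapK hd)
        (P := soloInformedSwapK P) (soloInformed_le_deg_swapK hsP) hss (t := 0) hκ₂0 hκ₂1
        hlam0.ne' (by rw [map_zero]) (by rw [map_zero, zero_add]; exact hlam0.le)
        (by rw [map_zero, mul_zero]; exact zero_le_one) hks
        (fun y hy0 hy1 => by rw [map_zero, zero_add]; exact hrootS' y hy0 hy1)
        (hchildS κ₂ _ hκ₂0 hκ₂1 hlam0 hlam1 hrootS')
      refine (soloInformed_presOn_congr fun z _ => ?_).1 hpiece
      show _ = f _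
      simp only [hf_def, soloInformed_aeval_swapK]
  -- (C) the grid cells off the corner are leaves
  have hcell : ∀ j' : Fin 2 → Fin (N * M), 1 ≤ (j' 0 : ℕ) → (j' 0 : ℕ) < M → (j' 1 : ℕ) < M →
      SoloInformedPresOn (Ω ∩ soloInformedGridCell (N * M) j') f := by
    intro j' hj1 _ _
    refine soloInformed_presOn_inter_gridCell_of_leafCfg hK hKrc P D F h.isOpen h.isSemialgebraic
      h.frontier hNM j' fun z hz hzcl hFz =>
      h.invB z (soloInformedGridCell_subset_cube j' hz) (fun hz0 => ?_) hzcl hFz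
    have h1 := (hz 0).1
    rw [hz0] at h1
    have h2 : (0 : ℝ) < ((j' 0 : ℕ) : ℝ) / (N * M : ℕ) := div_pos (by exact_mod_cast hj1) hNMr
    exact absurd (h2.trans_le h1) (lt_irrefl _)
  exact soloInformed_presOn_inter_cornerCell hK h.isSemialgebraic h.subset hN hM hfan hswap hcell hj

end Summit.KontsevichZagierPeriods.KontsevichZagierPeriods.Theorems
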